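import Literature.MathematicalPhysics.QuantumFieldTheory.Balaban1983to89.Node00.BackgroundActionOfRecord
import Literature.MathematicalPhysics.QuantumFieldTheory.Balaban1983to89.T4FlagMemoryTwoRun

/-!
# Node00 / BackgroundActionT — the stage-₈a objects OVER A GENERIC BLOCK TRANSPORT, and (0.23)∕(1.3) AT THE RECORD reduced to named hypotheses

[Balaban1987RG1] = [I] (CMP 109, 1987) (0.19)–(0.20) pp. 255–256, (0.22)–(0.23) p. 256, (1.1) p. 260, (1.3) p. 260, (1.6) p. 261;
[Balaban1985Variational] = [B11] (CMP 102, 1985) Thm 1 p. 279.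

Append-only successor of `Node00.BackgroundActionOfRecord` (stage ₈a, seat pub-ymgap-node00-def-B).  TWO things.

(A) **TRANSPORT-GENERIC LAYER.**  Stage ₅ fixes the renormalisation transformation of record as `TrhoOfRecord = rnTransport …` — a CHOSEN
VERSION of a Radon–Nikodym derivative (`AveragingRT.rnDensity`) — so every value `A_{k+1}(V) = log(𝐍_k⁻¹ · (T_k …)(V))` and every `𝐍_k =
(T_k …)(1)` of ₈a is a point value of an RN version (typing findings [N13-B-G2-STAGE7-POINTWISE], [NODE00-DEF-B-G0-POINTWISE-8],
[DAGN09A-G2-HINV-TYPING-NOTE], pub-ymgap INBOX 2026-08-25).  ₈a's definitions and bookkeeping are TRANSPORT-AGNOSTIC; this module makes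
that explicit: every ₈a object is re-issued over a transport family `T : (K k : ℕ) → Density_k → Density_{k+1}` (`effActionHT`,
`normConstHT`, `normConstOfRecordT`, `effActionOfRecordT`, `EkOfRecordT`, `mergedTermT`, `mergedTermFamilyT`, `mergedTermFamilyMatT`,
`ReprAOfRecordT`, `IndAOfRecordT`), and the ₈a objects ARE these at `T := TOfRecord` BY `rfl` (`effActionH_eq_T`, …, `indAOfRecord_eq_T`).  A Stage-5
successor carrying an explicit (represented ∕ fibre-integral) transport `T'` then re-plugs three tokens; nothing in ₈a is edited.

(B) **(0.23) ∕ (1.3) AT THE RECORD, generic in `T`.**  The telescoping of the merged terms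
`𝓝_{j+1}(Ū^{j+1}(U_k V)) = A_{j+1}(Ū^{j+1}U_kV) − A_j(Ū^j(U_{j+1}(Ū^{j+1}U_kV)))` against the telescoping of the couplings (0.20)
`Σ_{j<k} β_{j+1} = 1/g_0² − 1/g_k²` (the tree's `FlowStep.inv_sq_telescopeH`), so that `ReprAOfRecordT` ∕ `IndAOfRecordT` at the record's
own objects FOLLOW from located NAMED hypotheses on the domain (asserted nowhere): `HCompT` — composition of minimisers seen by the
actions —, itself ⇐ `HOrbit` (one residual orbit, [I] (1.1); ⇐ `HRestrict` «the global minimiser restricts», [B11] Thm 1 (9)–(10), +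
₈a's `UniqueUkOrbit` at the intermediate levels) + `HInvT` (invariance of `A_j ∘ Ū^j` under the residual group, [I] (0.21) ∕ p. 257);
the flow recursion `FlowStep.RGEqH k β (genSeq β g₀)`; (1.1) solvability `UkExists`; locality of `χ` in the couplings (discharged for
pointwise families such as stage ₇'s `chiOfRecord ν g K n` by `chi_extd_prefixOf_of_pointwise`).  The ₈a-named statements are the
`T := TOfRecord` instances (`reprAOfRecord_atRecord`, `indAOfRecord_atRecord`).  For `k ≤ 2` no `HInvT` at a level `j ≥ 1` is needed.
HONEST FRAMING: definitions of record re-issued over a parameter + kernel-checked bookkeeping identities with the print content isolated as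
NAMED hypotheses; nothing of Bałaban's asserted; no estimate; counts unmoved; NOT continuum ∕ ℝ⁴ ∕ OS ∕ mass-gap ∕ Clay.
-/

noncomputable section

namespace Literature.MathematicalPhysics.QuantumFieldTheory.Balaban1983to89.Node00

open T4Continuum (T4Family)
open FlowStep (HBeta prefixOf RGEqH)
open FlowStepRuns (genSeq)
open T4FlagMemory (extd)
open T4FlagMemoryTwoRun (extd_prefixOf)
open B12Eq019ActionBody (printedSeq nextAction wilsonTerm normConst integrand)
open B12GaugeOrbits021 (OrbitRel)

variable (F : T4Family) (N : ℕ) [NeZero N]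

/-! ## §1. Transport families and the ₈a objects over them -/

/-- A BLOCK TRANSPORT FAMILY: per torus `K` and step `k`, a map from level-`k` densities to level-`(k+1)` densities (print's `T_k` of
(0.19), whatever version of it a stage carries). [cite: Balaban1987RG1, (0.19) p.255] -/
def Transport : Type _ := (K k : ℕ) → Density (F.P K) k (SU N) → Density (F.P K) (k + 1) (SU N)

/-- The transport OF RECORD of stage ₅ as a family (`Node00.DatumAvLayer.TrhoOfRecord`, the RN-version transport). [cite: Balaban1987RG1, (0.19) p.255] -/
def TOfRecord : Transport F N := fun K k => TrhoOfRecord F N K k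

/-- `A_k` over a generic transport: the printed recursion (0.17)∕(0.19) `printedSeq` at `T`, the characteristic functions `χ K g` and the
pinned gauge fixing of record. [cite: Balaban1987RG1, (0.17)–(0.19) p.255] -/
def effActionHT (T : Transport F N) (χ : (K : ℕ) → (ℕ → ℝ) → (k : ℕ) → Density (F.P K) k (SU N)) (K : ℕ) (g : ℕ → ℝ) :
    (k : ℕ) → Density (F.P K) k (SU N) :=
  printedSeq (T K) (χ K g) (gfOfRecord F N K) g 1

/-- ₈a's `effActionH` IS the generic one at the transport of record. [cite: Balaban1987RG1, (0.19) p.255 (bookkeeping)] -/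
theorem effActionH_eq_T (χ : (K : ℕ) → (ℕ → ℝ) → (k : ℕ) → Density (F.P K) k (SU N)) (K : ℕ) (g : ℕ → ℝ) :
    effActionH F N χ K g = effActionHT F N (TOfRecord F N) χ K g := rfl

/-- `A_0 = −(1/g_0²)A` for every transport. [cite: Balaban1987RG1, (0.17) p.255] -/
theorem effActionHT_zero (T : Transport F N) (χ : (K : ℕ) → (ℕ → ℝ) → (k : ℕ) → Density (F.P K) k (SU N)) (K : ℕ) (g : ℕ → ℝ) :
    effActionHT F N T χ K g 0 = wilsonTerm (g 0) 1 := rfl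

/-- `A_{k+1} = 𝐓_k A_k` at the transport `T`. [cite: Balaban1987RG1, (0.19) p.255] -/
theorem effActionHT_succ (T : Transport F N) (χ : (K : ℕ) → (ℕ → ℝ) → (k : ℕ) → Density (F.P K) k (SU N)) (K : ℕ) (g : ℕ → ℝ)
    (k : ℕ) : effActionHT F N T χ K g (k + 1) =
      nextAction (T K k) (χ K g k) (gfOfRecord F N K k) (g k) (effActionHT F N T χ K g k) := rfl

/-- `𝐍_k` over a generic transport. [cite: Balaban1987RG1, (0.19) p.255] -/
def normConstHT (T : Transport F N) (χ : (K : ℕ) → (ℕ → ℝ) → (k : ℕ) → Density (F.P K) k (SU N)) (K : ℕ) (g : ℕ → ℝ) (k : ℕ) : ℝ :=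
  normConst (T K k) (χ K g k) (gfOfRecord F N K k) (g k) (effActionHT F N T χ K g k)

/-- ₈a's `normConstH` at the transport of record. [cite: Balaban1987RG1, (0.19) p.255 (bookkeeping)] -/
theorem normConstH_eq_T (χ : (K : ℕ) → (ℕ → ℝ) → (k : ℕ) → Density (F.P K) k (SU N)) (K : ℕ) (g : ℕ → ℝ) (k : ℕ) :
    normConstH F N χ K g k = normConstHT F N (TOfRecord F N) χ K g k := rfl

/-- `𝐍_k` of run `p` over a generic transport. [cite: Balaban1987RG1, (0.19)–(0.20) pp.255–256] -/
def normConstOfRecordT (T : Transport F N) (χ : (K : ℕ) → (ℕ → ℝ) → (k : ℕ) → Density (F.P K) k (SU N)) (β : HBeta)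
    (p : B12.RunParams) (k : ℕ) : ℝ :=
  normConstHT F N T χ p.K (genSeq β p.g0) k

/-- Bridge. [cite: Balaban1987RG1, (0.19) p.255 (bookkeeping)] -/
theorem normConstOfRecord_eq_T (χ : (K : ℕ) → (ℕ → ℝ) → (k : ℕ) → Density (F.P K) k (SU N)) (β : HBeta) (p : B12.RunParams) (k : ℕ) :
    normConstOfRecord F N χ β p k = normConstOfRecordT F N (TOfRecord F N) χ β p k := rfl

/-- `A_k(g_k, V)` of run `p` over a generic transport. [cite: Balaban1987RG1, (0.19)–(0.20) pp.255–256] -/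
def effActionOfRecordT (T : Transport F N) (χ : (K : ℕ) → (ℕ → ℝ) → (k : ℕ) → Density (F.P K) k (SU N)) (β : HBeta)
    (p : B12.RunParams) (k : ℕ) (V : GaugeField (F.P p.K) k (SU N)) : ℝ :=
  effActionHT F N T χ p.K (genSeq β p.g0) k V

/-- Bridge. [cite: Balaban1987RG1, (0.19) p.255 (bookkeeping)] -/
theorem effActionOfRecord_eq_T (χ : (K : ℕ) → (ℕ → ℝ) → (k : ℕ) → Density (F.P K) k (SU N)) (β : HBeta) (p : B12.RunParams) (k : ℕ) :
    effActionOfRecord F N χ β p k = effActionOfRecordT F N (TOfRecord F N) χ β p k := rfl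

/-- `𝐄_k := A_k + (1/g_k²)A^η(U_k)` ((0.22) as definition) over a generic transport.  JUNK NOTE (referee pin F-defB-2, also for ₈a's
`EkOfRecord`): at a coupling `g_k = 0` Mathlib's `1 / 0 = 0` makes the background summand vanish — a junk value off every in-interval run
(`genSeq β g₀ k > 0` there), never read by a face of record.  ERRATUM to ₈a's header (pin F-defB-1): display (0.24) of [I] is on p. 257,
not p. 256. [cite: Balaban1987RG1, (0.22) p.256 and p.265] -/
def EkOfRecordT (T : Transport F N) (χ : (K : ℕ) → (ℕ → ℝ) → (k : ℕ) → Density (F.P K) k (SU N)) (ε : ℝ) (β : HBeta)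
    (p : B12.RunParams) (k : ℕ) (V : GaugeField (F.P p.K) k (SU N)) : ℝ :=
  effActionOfRecordT F N T χ β p k V + (1 / (genSeq β p.g0 k) ^ 2) * wilsonBGOfRecord F N ε p k V

/-- Bridge. [cite: Balaban1987RG1, (0.22) p.256 (bookkeeping)] -/
theorem EkOfRecord_eq_T (χ : (K : ℕ) → (ℕ → ℝ) → (k : ℕ) → Density (F.P K) k (SU N)) (ε : ℝ) (β : HBeta) (p : B12.RunParams) (k : ℕ) :
    EkOfRecord F N χ ε β p k = EkOfRecordT F N (TOfRecord F N) χ ε β p k := rfl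

/-- The merged per-step term `𝓝_{k+1}(g; W) := A_{k+1}(g; W) − A_k(g; Ū^k(U_{k+1}(W)))` ((1.6)) over a generic transport.
[cite: Balaban1987RG1, (1.6) p.261] -/
def mergedTermT (T : Transport F N) (χ : (K : ℕ) → (ℕ → ℝ) → (k : ℕ) → Density (F.P K) k (SU N)) (ε : ℝ) (K : ℕ) (g : ℕ → ℝ)
    (k : ℕ) (W : GaugeField (F.P K) (k + 1) (SU N)) : ℝ :=
  effActionHT F N T χ K g (k + 1) W - effActionHT F N T χ K g k (Averaging.iter (avOfRecord F N K) k (Uk F N K (k + 1) ε W))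

/-- Bridge. [cite: Balaban1987RG1, (1.6) p.261 (bookkeeping)] -/
theorem mergedTerm_eq_T (χ : (K : ℕ) → (ℕ → ℝ) → (k : ℕ) → Density (F.P K) k (SU N)) (ε : ℝ) (K : ℕ) (g : ℕ → ℝ) (k : ℕ) :
    mergedTerm F N χ ε K g k = mergedTermT F N (TOfRecord F N) χ ε K g k := rfl

/-- The merged term family (β-layer shape) over a generic transport, read through `r : 𝔄 → SU(N)`. [cite: Balaban1987RG1, (1.20)–(1.22) p.264] -/
def mergedTermFamilyT (T : Transport F N) (χ : (K : ℕ) → (ℕ → ℝ) → (k : ℕ) → Density (F.P K) k (SU N)) (ε : ℝ) {𝔄 : Type*}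
    (r : 𝔄 → SU N) : (k : ℕ) → (Fin (k + 1) → ℝ) → (K : ℕ) → ((Fin (F.P K).d → Site (F.P K) (k + 1) → 𝔄) → ℝ) :=
  fun k hist K W => mergedTermT F N T χ ε K (extd hist) k (readField F N r W)

/-- Bridge (hence also for `mergedTermFamilyMat = mergedTermFamily … (suOfMat N)`). [cite: Balaban1987RG1, (1.20) p.264 (bookkeeping)] -/
theorem mergedTermFamily_eq_T (χ : (K : ℕ) → (ℕ → ℝ) → (k : ℕ) → Density (F.P K) k (SU N)) (ε : ℝ) {𝔄 : Type*} (r : 𝔄 → SU N) :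
    mergedTermFamily F N χ ε r = mergedTermFamilyT F N (TOfRecord F N) χ ε r := rfl

/-- The matrix-carrier export over a generic transport (`𝔄 := Matrix (Fin N) (Fin N) ℂ`, read through `suOfMat`), the shape
`Node00.BetaOfRecord.betaMerged` consumes. [cite: Balaban1987RG1, (1.20)–(1.22) p.264] -/
def mergedTermFamilyMatT (T : Transport F N) (χ : (K : ℕ) → (ℕ → ℝ) → (k : ℕ) → Density (F.P K) k (SU N)) (ε : ℝ) :
    (k : ℕ) → (Fin (k + 1) → ℝ) → (K : ℕ) → ((Fin (F.P K).d → Site (F.P K) (k + 1) → Matrix (Fin N) (Fin N) ℂ) → ℝ) :=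
  mergedTermFamilyT F N T χ ε (suOfMat N)

/-- Bridge. [cite: Balaban1987RG1, (1.20) p.264 (bookkeeping)] -/
theorem mergedTermFamilyMat_eq_T (χ : (K : ℕ) → (ℕ → ℝ) → (k : ℕ) → Density (F.P K) k (SU N)) (ε : ℝ) :
    mergedTermFamilyMat F N χ ε = mergedTermFamilyMatT F N (TOfRecord F N) χ ε := rfl

/-- The format predicate (0.22) ∧ (0.23) over a generic transport (same arguments as ₈a's `ReprAOfRecord`). [cite: Balaban1987RG1, (0.22)–(0.23) p.256] -/
def ReprAOfRecordT (T : Transport F N) (χ : (K : ℕ) → (ℕ → ℝ) → (k : ℕ) → Density (F.P K) k (SU N)) (ε : ℝ) (β : HBeta)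
    (p : B12.RunParams) (k : ℕ) (hist : Fin (k + 1) → ℝ) (dom : Set (GaugeField (F.P p.K) k (SU N)))
    (A W E : GaugeField (F.P p.K) k (SU N) → ℝ) : Prop :=
  (∀ V ∈ dom, A V = -(1 / (hist (Fin.last k)) ^ 2) * W V + E V) ∧
  (∀ V ∈ dom, E V = ∑ j ∈ Finset.range k,
      (-(β j (prefixOf (extd hist) j)) * W V +
        mergedTermT F N T χ ε p.K (extd hist) j (Averaging.iter (avOfRecord F N p.K) (j + 1) (Uk F N p.K k ε V))))

/-- Bridge. [cite: Balaban1987RG1, (0.22)–(0.23) p.256 (bookkeeping)] -/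
theorem reprAOfRecord_eq_T (χ : (K : ℕ) → (ℕ → ℝ) → (k : ℕ) → Density (F.P K) k (SU N)) (ε : ℝ) (β : HBeta) (p : B12.RunParams) (k : ℕ) :
    ReprAOfRecord F N χ ε β p k = ReprAOfRecordT F N (TOfRecord F N) χ ε β p k := rfl

/-- The inductive-assumption predicate (1.1) ∧ (0.22)–(0.23) over a generic transport. [cite: Balaban1987RG1, (1.1)–(1.3) p.260] -/
def IndAOfRecordT (T : Transport F N) (χ : (K : ℕ) → (ℕ → ℝ) → (k : ℕ) → Density (F.P K) k (SU N)) (ε : ℝ) (β : HBeta)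
    (p : B12.RunParams) (k : ℕ) (hist : Fin (k + 1) → ℝ) (dom : Set (GaugeField (F.P p.K) k (SU N)))
    (A W E : GaugeField (F.P p.K) k (SU N) → ℝ) : Prop :=
  (∀ V ∈ dom, UkExists F N p.K k ε V ∧ UniqueUkOrbit F N p.K k ε V) ∧ ReprAOfRecordT F N T χ ε β p k hist dom A W E

/-- Bridge. [cite: Balaban1987RG1, (1.3) p.260 (bookkeeping)] -/
theorem indAOfRecord_eq_T (χ : (K : ℕ) → (ℕ → ℝ) → (k : ℕ) → Density (F.P K) k (SU N)) (ε : ℝ) (β : HBeta) (p : B12.RunParams) (k : ℕ) :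
    IndAOfRecord F N χ ε β p k = IndAOfRecordT F N (TOfRecord F N) χ ε β p k := rfl

/-- (0.22) at the record's objects, generic transport: by `ring`. [cite: Balaban1987RG1, (0.22) p.256] -/
theorem reprAOfRecordT_fst_atRecord (T : Transport F N) (χ : (K : ℕ) → (ℕ → ℝ) → (k : ℕ) → Density (F.P K) k (SU N)) (ε : ℝ)
    (β : HBeta) (p : B12.RunParams) (k : ℕ) (dom : Set (GaugeField (F.P p.K) k (SU N))) :
    ∀ V ∈ dom, effActionOfRecordT F N T χ β p k V =
      -(1 / (prefixOf (genSeq β p.g0) k (Fin.last k)) ^ 2) * wilsonBGOfRecord F N ε p k V + EkOfRecordT F N T χ ε β p k V := by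
  intro V _
  rw [FlowStep.prefixOf_apply, Fin.val_last]
  unfold EkOfRecordT
  ring

/-! ## §2. Bookkeeping on histories, the printed sequence and the couplings -/

variable {F N}

/-- The prefixes of the clamped extension `extd (prefixOf g k)` are the prefixes of `g` (from the tree's
`T4FlagMemoryTwoRun.extd_prefixOf`, cited not restated). [cite: Balaban1987RG1, (0.20) p.256 (bookkeeping)] -/
theorem prefixOf_extd_prefixOf {g : ℕ → ℝ} {k j : ℕ} (h : j ≤ k) : prefixOf (extd (prefixOf g k)) j = prefixOf g j := by
  funext i
  rw [FlowStep.prefixOf_apply, FlowStep.prefixOf_apply]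
  exact extd_prefixOf ((Nat.le_of_lt_succ i.isLt).trans h)

/-- **LOCALITY OF THE PRINTED SEQUENCE IN THE COUPLINGS** (any transport): `A_m` (`m ≤ k`) reads only `g_0, …, g_k` and `χ_0, …, χ_k`.
[cite: Balaban1987RG1, (0.19) p.255 (bookkeeping)] -/
theorem effActionHT_congr (T : Transport F N) (χ : (K : ℕ) → (ℕ → ℝ) → (k : ℕ) → Density (F.P K) k (SU N)) {K k : ℕ}
    {g g' : ℕ → ℝ} (hg : ∀ n ≤ k, g n = g' n) (hχ : ∀ n ≤ k, χ K g n = χ K g' n) :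
    ∀ m ≤ k, effActionHT F N T χ K g m = effActionHT F N T χ K g' m := by
  intro m
  induction m with
  | zero => intro _; rw [effActionHT_zero, effActionHT_zero, hg 0 (Nat.zero_le _)]
  | succ m ih =>
    intro hm
    have hm' : m ≤ k := Nat.le_of_succ_le hm
    rw [effActionHT_succ, effActionHT_succ, ih hm', hg m hm', hχ m hm']

omit [NeZero N] in
/-- **DISCHARGE OF THE χ-LOCALITY HYPOTHESIS FOR POINTWISE FAMILIES**: if `χ_n` reads the couplings only through `g_n` (stage ₇'s
`chiOfRecord ν g K n` does), the clamped history and the run give the same characteristic functions up to `k`.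
[cite: Balaban1987RG1, (0.26) p.257 (bookkeeping)] -/
theorem chi_extd_prefixOf_of_pointwise (χ : (K : ℕ) → (ℕ → ℝ) → (k : ℕ) → Density (F.P K) k (SU N))
    (hpt : ∀ K g n, χ K g n = χ K (fun _ => g n) n) (K k : ℕ) (g : ℕ → ℝ) :
    ∀ n ≤ k, χ K (extd (prefixOf g k)) n = χ K g n := by
  intro n hn
  rw [hpt K (extd (prefixOf g k)) n, extd_prefixOf hn]
  exact (hpt K g n).symm

/-- **TELESCOPING OF THE COUPLINGS (0.20)**: `Σ_{j<k} β_{j+1}(g_0,…,g_j) = 1/g_0² − 1/g_k²` along a run — the `range`-form of the tree's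
`FlowStep.inv_sq_telescopeH` (cited, not restated). [cite: Balaban1987RG1, (0.20) p.256] -/
theorem sum_beta_eq_of_rgEqH {β : HBeta} {g : ℕ → ℝ} {k : ℕ} (h : RGEqH k β g) :
    ∑ j ∈ Finset.range k, β j (prefixOf g j) = 1 / (g 0) ^ 2 - 1 / (g k) ^ 2 := by
  rw [Finset.range_eq_Ico, ← sub_eq_iff_eq_add'.2 (FlowStep.inv_sq_telescopeH h (Nat.zero_le k) le_rfl)]

variable (F N)

/-! ## §3. The located hypotheses, NAMED (asserted nowhere) -/

/-- **COMPOSITION OF MINIMISERS SEEN BY THE ACTIONS** (transport `T`): for `V ∈ dom`, `j < k`,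
`A_j(g; Ū^j(U_{j+1}(Ū^{j+1}(U_k V)))) = A_j(g; Ū^j(U_k V))`. [cite: Balaban1987RG1, (1.1) p.260; Balaban1985Variational, Thm 1 p.279] -/
def HCompT (T : Transport F N) (χ : (K : ℕ) → (ℕ → ℝ) → (k : ℕ) → Density (F.P K) k (SU N)) (ε : ℝ) (K : ℕ) (g : ℕ → ℝ) (k : ℕ)
    (dom : Set (GaugeField (F.P K) k (SU N))) : Prop :=
  ∀ V ∈ dom, ∀ j < k,
    effActionHT F N T χ K g j (Averaging.iter (avOfRecord F N K) j
        (Uk F N K (j + 1) ε (Averaging.iter (avOfRecord F N K) (j + 1) (Uk F N K k ε V)))) =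
      effActionHT F N T χ K g j (Averaging.iter (avOfRecord F N K) j (Uk F N K k ε V))

/-- **ONE RESIDUAL ORBIT** ([I] (1.1) «exactly one … orbit»): for `V ∈ dom`, `j < k`, the level-`(j+1)` minimiser of record over
`Ū^{j+1}(U_k V)` lies in the residual orbit (level `j+1`) of `U_k V`.  Transport-free. [cite: Balaban1987RG1, (1.1) p.260] -/
def HOrbit (ε : ℝ) (K k : ℕ) (dom : Set (GaugeField (F.P K) k (SU N))) : Prop :=
  ∀ V ∈ dom, ∀ j < k, OrbitRel (j + 1) (Uk F N K k ε V)
    (Uk F N K (j + 1) ε (Averaging.iter (avOfRecord F N K) (j + 1) (Uk F N K k ε V)))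

/-- **INVARIANCE OF `A_j ∘ Ū^j` UNDER THE RESIDUAL GROUP OF LEVEL `j+1`** (`j < k`), transport `T`.
[cite: Balaban1987RG1, (0.21) p.256 («invariant with respect to the gauge transformations u … u = 1 on T⁽ᵏ⁾»); (0.24) p.257 («gauge invariant functions of U»)] -/
def HInvT (T : Transport F N) (χ : (K : ℕ) → (ℕ → ℝ) → (k : ℕ) → Density (F.P K) k (SU N)) (K : ℕ) (g : ℕ → ℝ) (k : ℕ) : Prop :=
  ∀ j < k, ∀ u : GaugeTransf (F.P K) 0 (SU N), B12GaugeOrbits021.IsResidual (j + 1) u →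
    ∀ U : GaugeField (F.P K) 0 (SU N),
      effActionHT F N T χ K g j (Averaging.iter (avOfRecord F N K) j (GaugeField.gaugeAct u U)) =
        effActionHT F N T χ K g j (Averaging.iter (avOfRecord F N K) j U)

/-- **THE GLOBAL MINIMISER RESTRICTS** ([B11] side of `HOrbit`): for `V ∈ dom`, `j < k`, `U_k V` is a level-`(j+1)` minimiser over its own
average `Ū^{j+1}(U_k V)`.  Transport-free. [cite: Balaban1985Variational, Thm 1 (8)–(10) p.279] -/
def HRestrict (ε : ℝ) (K k : ℕ) (dom : Set (GaugeField (F.P K) k (SU N))) : Prop :=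
  ∀ V ∈ dom, ∀ j < k, IsBackground (avOfRecord F N K) (bgReg F N K (j + 1) ε) (j + 1)
    (Averaging.iter (avOfRecord F N K) (j + 1) (Uk F N K k ε V)) (Uk F N K k ε V)

/-- `HRestrict` + uniqueness (1.1) at the intermediate levels ⇒ `HOrbit`. [cite: Balaban1987RG1, (1.1) p.260 (bookkeeping)] -/
theorem hOrbit_of_hRestrict_of_unique {ε : ℝ} {K k : ℕ} {dom : Set (GaugeField (F.P K) k (SU N))} (hR : HRestrict F N ε K k dom)
    (hU : ∀ V ∈ dom, ∀ j < k, UniqueUkOrbit F N K (j + 1) ε (Averaging.iter (avOfRecord F N K) (j + 1) (Uk F N K k ε V))) :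
    HOrbit F N ε K k dom := by
  intro V hV j hj
  have hB := hR V hV j hj
  exact hU V hV j hj _ _ hB (isBackground_Uk ⟨_, hB⟩)

/-- `HOrbit ∧ HInvT ⇒ HCompT`. [cite: Balaban1987RG1, (1.1) p.260 (bookkeeping)] -/
theorem hCompT_of_hOrbit_of_hInvT (T : Transport F N) (χ : (K : ℕ) → (ℕ → ℝ) → (k : ℕ) → Density (F.P K) k (SU N)) {ε : ℝ}
    {K : ℕ} {g : ℕ → ℝ} {k : ℕ} {dom : Set (GaugeField (F.P K) k (SU N))} (hO : HOrbit F N ε K k dom)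
    (hI : HInvT F N T χ K g k) : HCompT F N T χ ε K g k dom := by
  intro V hV j hj
  obtain ⟨u, hu, hEq⟩ := hO V hV j hj
  rw [hEq]
  exact hI j hj u hu _

/-! ## §4. (0.23) and (1.3) at the record, generic transport; the ₈a instances -/

/-- **THE MERGED TERMS TELESCOPE** (transport `T`): under `HCompT`, for `V ∈ dom` with the level-`k` problem solvable,
`Σ_{j<k} 𝓝_{j+1}(g; Ū^{j+1}(U_k V)) = A_k(g; V) + (1/g_0²)·A^η(U_k V)`. [cite: Balaban1987RG1, (0.23) p.256] -/
theorem sum_mergedTermT_eq (T : Transport F N) (χ : (K : ℕ) → (ℕ → ℝ) → (k : ℕ) → Density (F.P K) k (SU N)) (ε : ℝ) {K : ℕ}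
    (g : ℕ → ℝ) {k : ℕ} {dom : Set (GaugeField (F.P K) k (SU N))} (hcomp : HCompT F N T χ ε K g k dom)
    {V : GaugeField (F.P K) k (SU N)} (hV : V ∈ dom) (hk : UkExists F N K k ε V) :
    ∑ j ∈ Finset.range k, mergedTermT F N T χ ε K g j (Averaging.iter (avOfRecord F N K) (j + 1) (Uk F N K k ε V)) =
      effActionHT F N T χ K g k V + (1 / (g 0) ^ 2) * wilsonAction4 (Uk F N K k ε V) := by
  have step : ∀ j ∈ Finset.range k,
      mergedTermT F N T χ ε K g j (Averaging.iter (avOfRecord F N K) (j + 1) (Uk F N K k ε V)) =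
        effActionHT F N T χ K g (j + 1) (Averaging.iter (avOfRecord F N K) (j + 1) (Uk F N K k ε V)) -
          effActionHT F N T χ K g j (Averaging.iter (avOfRecord F N K) j (Uk F N K k ε V)) := by
    intro j hj
    unfold mergedTermT
    rw [hcomp V hV j (Finset.mem_range.1 hj)]
  rw [Finset.sum_congr rfl step,
    Finset.sum_range_sub (fun j => effActionHT F N T χ K g j (Averaging.iter (avOfRecord F N K) j (Uk F N K k ε V))) k,
    iter_Uk hk]
  show effActionHT F N T χ K g k V - wilsonTerm (g 0) 1 (Uk F N K k ε V) = _
  rw [B12Eq019ActionBody.wilsonTerm]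
  unfold wilsonAction4
  ring

/-- **(0.23) AT THE RECORD, GENERIC TRANSPORT, REDUCED TO ITS LOCATED HYPOTHESES.** [cite: Balaban1987RG1, (0.22)–(0.23) p.256] -/
theorem reprAOfRecordT_atRecord (T : Transport F N) (χ : (K : ℕ) → (ℕ → ℝ) → (k : ℕ) → Density (F.P K) k (SU N)) (ε : ℝ)
    (β : HBeta) (p : B12.RunParams) (k : ℕ) (dom : Set (GaugeField (F.P p.K) k (SU N)))
    (hχ : ∀ n ≤ k, χ p.K (extd (prefixOf (genSeq β p.g0) k)) n = χ p.K (genSeq β p.g0) n)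
    (hflow : RGEqH k β (genSeq β p.g0))
    (hk : ∀ V ∈ dom, UkExists F N p.K k ε V)
    (hcomp : HCompT F N T χ ε p.K (genSeq β p.g0) k dom) :
    ReprAOfRecordT F N T χ ε β p k (prefixOf (genSeq β p.g0) k) dom
      (effActionOfRecordT F N T χ β p k) (wilsonBGOfRecord F N ε p k) (EkOfRecordT F N T χ ε β p k) := by
  refine ⟨reprAOfRecordT_fst_atRecord F N T χ ε β p k dom, fun V hV => ?_⟩
  have hg : ∀ n ≤ k, extd (prefixOf (genSeq β p.g0) k) n = genSeq β p.g0 n := fun n hn => extd_prefixOf hn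
  have hA : ∀ m ≤ k, effActionHT F N T χ p.K (extd (prefixOf (genSeq β p.g0) k)) m = effActionHT F N T χ p.K (genSeq β p.g0) m :=
    effActionHT_congr T χ hg hχ
  have hsum : ∀ j ∈ Finset.range k,
      (-(β j (prefixOf (extd (prefixOf (genSeq β p.g0) k)) j)) * wilsonBGOfRecord F N ε p k V +
        mergedTermT F N T χ ε p.K (extd (prefixOf (genSeq β p.g0) k)) j
          (Averaging.iter (avOfRecord F N p.K) (j + 1) (Uk F N p.K k ε V))) =
      (-(β j (prefixOf (genSeq β p.g0) j)) * wilsonBGOfRecord F N ε p k V +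
        mergedTermT F N T χ ε p.K (genSeq β p.g0) j (Averaging.iter (avOfRecord F N p.K) (j + 1) (Uk F N p.K k ε V))) := by
    intro j hj
    have hjk : j < k := Finset.mem_range.1 hj
    rw [prefixOf_extd_prefixOf hjk.le]
    unfold mergedTermT
    rw [hA (j + 1) hjk, hA j hjk.le]
  rw [Finset.sum_congr rfl hsum, Finset.sum_add_distrib, sum_mergedTermT_eq F N T χ ε (genSeq β p.g0) hcomp hV (hk V hV),
    ← Finset.sum_mul, Finset.sum_neg_distrib, sum_beta_eq_of_rgEqH hflow]
  unfold EkOfRecordT effActionOfRecordT wilsonBGOfRecord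
  ring

/-- **(1.3) AT THE RECORD, GENERIC TRANSPORT**, same reduction with the (1.1) clauses on the domain. [cite: Balaban1987RG1, (1.3) p.260] -/
theorem indAOfRecordT_atRecord (T : Transport F N) (χ : (K : ℕ) → (ℕ → ℝ) → (k : ℕ) → Density (F.P K) k (SU N)) (ε : ℝ)
    (β : HBeta) (p : B12.RunParams) (k : ℕ) (dom : Set (GaugeField (F.P p.K) k (SU N)))
    (hχ : ∀ n ≤ k, χ p.K (extd (prefixOf (genSeq β p.g0) k)) n = χ p.K (genSeq β p.g0) n)
    (hflow : RGEqH k β (genSeq β p.g0))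
    (h11 : ∀ V ∈ dom, UkExists F N p.K k ε V ∧ UniqueUkOrbit F N p.K k ε V)
    (hcomp : HCompT F N T χ ε p.K (genSeq β p.g0) k dom) :
    IndAOfRecordT F N T χ ε β p k (prefixOf (genSeq β p.g0) k) dom
      (effActionOfRecordT F N T χ β p k) (wilsonBGOfRecord F N ε p k) (EkOfRecordT F N T χ ε β p k) :=
  ⟨h11, reprAOfRecordT_atRecord F N T χ ε β p k dom hχ hflow (fun V hV => (h11 V hV).1) hcomp⟩

/-- **(0.23) AT THE RECORD OF STAGE ₅∕₈a** (`T := TOfRecord`): ₈a's `ReprAOfRecord` at the record's own objects from χ-locality, the flow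
recursion, (1.1) solvability and `HCompT (TOfRecord F N)`. [cite: Balaban1987RG1, (0.22)–(0.23) p.256] -/
theorem reprAOfRecord_atRecord (χ : (K : ℕ) → (ℕ → ℝ) → (k : ℕ) → Density (F.P K) k (SU N)) (ε : ℝ) (β : HBeta)
    (p : B12.RunParams) (k : ℕ) (dom : Set (GaugeField (F.P p.K) k (SU N)))
    (hχ : ∀ n ≤ k, χ p.K (extd (prefixOf (genSeq β p.g0) k)) n = χ p.K (genSeq β p.g0) n)
    (hflow : RGEqH k β (genSeq β p.g0)) (hk : ∀ V ∈ dom, UkExists F N p.K k ε V)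
    (hcomp : HCompT F N (TOfRecord F N) χ ε p.K (genSeq β p.g0) k dom) :
    ReprAOfRecord F N χ ε β p k (prefixOf (genSeq β p.g0) k) dom
      (effActionOfRecord F N χ β p k) (wilsonBGOfRecord F N ε p k) (EkOfRecord F N χ ε β p k) :=
  reprAOfRecordT_atRecord F N (TOfRecord F N) χ ε β p k dom hχ hflow hk hcomp

/-- **(1.3) AT THE RECORD OF STAGE ₅∕₈a** (`T := TOfRecord`). [cite: Balaban1987RG1, (1.3) p.260] -/
theorem indAOfRecord_atRecord (χ : (K : ℕ) → (ℕ → ℝ) → (k : ℕ) → Density (F.P K) k (SU N)) (ε : ℝ) (β : HBeta)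
    (p : B12.RunParams) (k : ℕ) (dom : Set (GaugeField (F.P p.K) k (SU N)))
    (hχ : ∀ n ≤ k, χ p.K (extd (prefixOf (genSeq β p.g0) k)) n = χ p.K (genSeq β p.g0) n)
    (hflow : RGEqH k β (genSeq β p.g0)) (h11 : ∀ V ∈ dom, UkExists F N p.K k ε V ∧ UniqueUkOrbit F N p.K k ε V)
    (hcomp : HCompT F N (TOfRecord F N) χ ε p.K (genSeq β p.g0) k dom) :
    IndAOfRecord F N χ ε β p k (prefixOf (genSeq β p.g0) k) dom
      (effActionOfRecord F N χ β p k) (wilsonBGOfRecord F N ε p k) (EkOfRecord F N χ ε β p k) :=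
  indAOfRecordT_atRecord F N (TOfRecord F N) χ ε β p k dom hχ hflow h11 hcomp

end Literature.MathematicalPhysics.QuantumFieldTheory.Balaban1983to89.Node00

end
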